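/-
Copyright (c) 2026 the pub-hodgecm-mathlib formalisation cell (harness21).  Prover seat hodgecm-mathlib-K2E1-p13 (g2), Track B ∕ K2-LIT, h413 = `stmt-HodgeConjecture-24833`,
line `K2_E1_TraceFormulaBeta`, campaign «R8₂-sph EXHAUSTION» ∕ ROADCARD «5Res ENDGAME BY FAMILIES», dealer K2E1-plan (g7) ruling (163) «P2»: the RADIAL instantiation of
★ T5a `K2E1PseudoEisensteinPlancherelIsometry` over ★ (136) `K2E1ScalarUnitaryAxisContinuationCMTwo`.
-/
import Summits.HodgeConjecture.HodgeConjecture.Theorems.K2E1ScalarUnitaryAxisContinuationCMTwo   -- ★ (136) p859843 (K2E1-p12): `pseudoEisenstein_contourShift_of_fe`, `analyticAt_of_re_eq_half`, `apply_conj_eq_conj_apply`, §0; brings ★ T4b, ★ T2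
import Summits.HodgeConjecture.HodgeConjecture.Theorems.K2E1PseudoEisensteinPlancherelIsometry     -- ★ T5a ED. 2 p859878 (K2E1-p12): `plancherelForm∕Norm_of_innerProductFormula` (family-generic); brings ★ A `conj_vertical`
import HarnessLib

/-!
# P2 — `K2E1PseudoEisensteinPlancherelRadialCMTwo`: the Plancherel form `⟪θ_f, θ_{f′}⟫ = ⟪Uθ_f, Uθ_{f′}⟫` of the RADIAL pseudo-Eisenstein family of `U(1,1)_{L∕L⁺}`, modulo (FE)

Track B ∕ K2-LIT, crux h413 = `stmt-HodgeConjecture-24833`, route of record `HCCMUnconditional`; cell `hodgecm-mathlib`, squad K2, ENGINE E1.  THEOREMS ONLY (no `def`, no `instance`,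
no `notation`, no `sorry`; default heartbeats); lane `--supports stmt-HodgeConjecture-24833 --as helper` (count-neutral).

THE MATHEMATICS ([MoeglinWaldspurger1995, II.2.4, IV.1.10–IV.1.11, IV.3.12]; [Iwaniec2002, §6.3 Thm 6.6, §7.3]; [Langlands1976, §7]).  INPUT = the (E3) clauses of ★ EXPORTS₂ on a pair
`(P, cI)` as BINDERS in ★ (136)'s exact bytes (`P ⊆ {Re ≤ 1}` closed co-discrete; `cI` meromorphic in normal form on `ℂ`, analytic off `P`, `= (ν𝓕)⁻¹∫H(w₀v)^z dν` on `{1 < Re}`) + the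
functional-equation letter **(hFE)** `cI z · cI (1 − z) = 1` off `P ∪ (1 − P)` (★ T2′ F2 `K2E1ScatteringFunctionalEquationCMTwo`, letter-free on the EXPORTS₂ package).  ★ T5a
`plancherelForm_of_innerProductFormula (Φ Ψ s) (hIP) (hs1) (hss) (hG)` is FAMILY-GENERIC; THIS FILE discharges its three analytic letters for the radial family `(Φ, Ψ, s) =
(mellin f, mellin f′, cI)`:
* §1 THE AXIS PATH `t ↦ ½ + it`: it maps `𝓝[≠] t₀` into `𝓝[≠] (½ + it₀)` (`tendsto_axis_nhdsNE`), so co-discreteness of `P` pulls back: for every `t₀`, EVENTUALLY on `𝓝[≠] t₀` the axis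
  point `½ + it` avoids `P`, `1 − P`, `conj P` (`eventually_axis_notMem`, ★ (136) §0).
* §2 ON THE AXIS, MODULO (FE): `t ↦ cI(½ + it)` is CONTINUOUS (★ (136) `analyticAt_of_re_eq_half`: no pole on the axis) — `continuous_axis`; **(hs1) `‖cI(½ + it)‖ = 1` FOR EVERY `t`**
  (`norm_axis_eq_one`: at the generic axis points by ★ T2 `norm_eq_one_of_mul_one_sub_eq_one` ∘ (FE) ∘ ★ (136) `apply_conj_eq_conj_apply`, ACROSS the countably many exceptional points
  by continuity — limits along `𝓝[≠] t₀` are unique); **(hss) `cI(½ − it) = conj cI(½ + it)` FOR EVERY `t`** (`axis_reflect`: ★ (136) §2 generically, continuity across).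
* §3 HEAD **`pseudoEisenstein_plancherelForm_of_fe`**: for `f, f′ ∈ C²_c((0,∞))`, `σ₀ > 1`, the T1 strip bound `hB` (★ p859417's bytes on `cI`) and the inner-product identity `hIP` on the
  line `Re = σ₀` (★ FILE D∕Final's head with `(ν𝓕)⁻¹·c = cI`): `∃ r ≠ 0`, `(z − 1)cI(z) → r`, and
  **`IP = C·(r·f̃(−1)·conj f̃′(−1)) + C·((2π)⁻¹·∫_0^∞ U_f(t)·conj U_{f′}(t) dt)`**, `U_f(t) = f̃(−(½+it)) + cI(½−it)·f̃(−(½−it))` — ★ (136) `pseudoEisenstein_contourShift_of_fe` (contour shift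
  `σ₀ → ½` with the residue at `1`) then ★ T5a with (hs1), (hss) from §2 and (hG) = ★ T4b `integrable_innerProductIntegrand_vertical` at `σ = ½` on ★ (136)'s neighbourhood
  `exists_isOpen_differentiableOn_of_fe`; and the NORM form **`pseudoEisenstein_plancherelNorm_of_fe`** (`f′ = f`): `IP = C·(r·|f̃(−1)|²) + C·((2π)⁻¹·∫_0^∞ |U_f(t)|² dt)` — the
  ISOMETRY clause of ROADCARD T5 for the radial family: `⟪θ_f, θ_f⟫ = ‖Uθ_f‖²` in `ℂ ⊕ L²((0,∞))` with weights `(C·r, C·(2π)⁻¹)`.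
HONEST LABEL: HC_CM is proved only modulo the 7 printed citations (2 remaining named inputs: hLiu418 = `stmt-HodgeConjecture-24832`, h413 = `stmt-HodgeConjecture-24833`) until rung 0
closes; this file asserts no named fact, closes no socket; count-neutral; letters `hFE` (paid on the EXPORTS₂ package by ★ T2′ F2), `hB` (★ T1 p859417 ⇐ `hMS`), `hIP` (★ Final + `hcc`).

## References
* [MoeglinWaldspurger1995] C. Mœglin, J.-L. Waldspurger, *Spectral decomposition and Eisenstein series* (1995), II.2.4, IV.1.10–IV.1.11, IV.3.12.
* [Iwaniec2002] H. Iwaniec, *Spectral Methods of Automorphic Forms* (2nd ed., 2002), §6.3 Thm 6.6, §7.3.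
* [Langlands1976] R. P. Langlands, *On the Functional Equations Satisfied by Eisenstein Series*, LNM 544 (1976), §7.
-/

set_option autoImplicit false
set_option linter.dupNamespace false  -- the mandated namespace repeats the summit's segment (`HodgeConjecture.HodgeConjecture`)

noncomputable section

open MeasureTheory Measure Set Filter Topology Complex NumberField
open scoped Real NNReal ENNReal ComplexConjugate
open Literature.NumberTheory.Automorphic Literature.NumberTheory.Automorphic.UnitaryGroup AdelicGroupData
open Summit.HodgeConjecture.HodgeConjecture.Cruxes.H413.K2E1MellinPaleyWienerHalfLine (conj_vertical)
open Summit.HodgeConjecture.HodgeConjecture.Cruxes.H413.K2E1ScatteringUnitaryAxisCMTwo (norm_eq_one_of_mul_one_sub_eq_one)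
open Summit.HodgeConjecture.HodgeConjecture.Cruxes.H413.K2E1PseudoEisensteinContourShiftCMTwo (integrable_innerProductIntegrand_vertical)
open Summit.HodgeConjecture.HodgeConjecture.Cruxes.H413.K2E1ScalarUnitaryAxisContinuationCMTwo (eventually_one_sub_notMem_and_conj_notMem analyticAt_of_re_eq_half apply_conj_eq_conj_apply
  exists_isOpen_differentiableOn_of_fe pseudoEisenstein_contourShift_of_fe)
open Summit.HodgeConjecture.HodgeConjecture.Cruxes.H413.K2E1PseudoEisensteinPlancherelIsometry (plancherelForm_of_innerProductFormula plancherelNorm_of_innerProductFormula)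

namespace Summit.HodgeConjecture.HodgeConjecture.Cruxes.H413.K2E1PseudoEisensteinPlancherelRadialCMTwo

/-! ## §1 The axis path `t ↦ ½ + it` and co-discreteness pulled back along it -/

/-- **The axis path maps punctured neighbourhoods to punctured neighbourhoods**: `t ↦ ½ + it` is continuous and injective. [folklore] -/
theorem tendsto_axis_nhdsNE (t₀ : ℝ) :
    Tendsto (fun t : ℝ => (((1 / 2 : ℝ)) : ℂ) + t * I) (𝓝[≠] t₀) (𝓝[≠] ((((1 / 2 : ℝ)) : ℂ) + t₀ * I)) :=
  (continuous_const.add (continuous_ofReal.mul continuous_const)).continuousWithinAt.tendsto_nhdsWithin fun t ht h => ht (by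
    have h' := congrArg Complex.im h
    simpa using h')

/-- **Eventually along the axis the point `½ + it` avoids `P`, `1 − P` and `conj P`** (`P` co-discrete; ★ (136) §0 pulled back along the axis path). [folklore] -/
theorem eventually_axis_notMem {P : Set ℂ} (hPcd : ∀ z₀ : ℂ, ∀ᶠ s in 𝓝[≠] z₀, s ∉ P) (t₀ : ℝ) :
    ∀ᶠ t : ℝ in 𝓝[≠] t₀, ((((1 / 2 : ℝ)) : ℂ) + (t : ℂ) * I) ∉ P ∧ (1 - ((((1 / 2 : ℝ)) : ℂ) + (t : ℂ) * I) ∉ P ∧ conj ((((1 / 2 : ℝ)) : ℂ) + (t : ℂ) * I) ∉ P) :=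
  (tendsto_axis_nhdsNE t₀).eventually ((hPcd _).and (eventually_one_sub_notMem_and_conj_notMem hPcd _))

/-! ## §2 On the unitary axis, modulo (FE): continuity, unit modulus, reflection symmetry — at EVERY axis point -/

variable (L : Type) [Field L] [NumberField L] [IsCMField L]
variable [MeasurableSpace (quasiSplit (↥(maximalRealSubfield L)) L (IsCMField.complexConj L) 2).Adelic] [BorelSpace (quasiSplit (↥(maximalRealSubfield L)) L (IsCMField.complexConj L) 2).Adelic]

section Scalar

variable (ν : Measure ↥(adelicUnipotent (↥(maximalRealSubfield L)) L (IsCMField.complexConj L) 2)) [ν.IsHaarMeasure]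
  {𝓕 : Set ↥(adelicUnipotent (↥(maximalRealSubfield L)) L (IsCMField.complexConj L) 2)}
  (h𝓕N : IsFundamentalDomain ↥(rationalUnipotent (↥(maximalRealSubfield L)) L (IsCMField.complexConj L) 2) 𝓕 ν) (h𝓕c : IsCompact (closure 𝓕))
  {P : Set ℂ} {cI : ℂ → ℂ}
  (hPc : IsClosed P) (hPcd : ∀ z₀ : ℂ, ∀ᶠ s in 𝓝[≠] z₀, s ∉ P) (hPre : ∀ z ∈ P, z.re ≤ 1)
  (hcNF : MeromorphicNFOn cI univ) (hcan : ∀ z : ℂ, z ∉ P → AnalyticAt ℂ cI z)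
  (hcc : ∀ z : ℂ, 1 < z.re → cI z = ((((ν 𝓕).toReal⁻¹ : ℝ)) : ℂ) * (∫ v : ↥(adelicUnipotent (↥(maximalRealSubfield L)) L (IsCMField.complexConj L) 2),
    (((borelHeight ((quasiSplit (↥(maximalRealSubfield L)) L (IsCMField.complexConj L) 2).toAdelic (weylLongU ((IsCMField.complexConj L : L ≃ₐ[↥(maximalRealSubfield L)] L) : L →+* L)
      (rfl : (StdForm.antidiagonal 2).over L = (StdForm.antidiagonal 2).over L)) * (v : (quasiSplit (↥(maximalRealSubfield L)) L (IsCMField.complexConj L) 2).Adelic)) : ℝ) : ℂ) ^ z) ∂ν))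

omit [BorelSpace (quasiSplit (↥(maximalRealSubfield L)) L (IsCMField.complexConj L) 2).Adelic] [ν.IsHaarMeasure] in
include hPc hPcd hPre hcNF hcan hcc in
/-- **`t ↦ cI(½ + it)` IS CONTINUOUS, modulo (FE)** — `cI` is analytic at every axis point (★ (136) `analyticAt_of_re_eq_half`). [cite: MoeglinWaldspurger1995, IV.3.12] -/
theorem continuous_axis (hFE : ∀ z : ℂ, z ∉ P → 1 - z ∉ P → cI z * cI (1 - z) = 1) : Continuous fun t : ℝ => cI ((((1 / 2 : ℝ)) : ℂ) + t * I) :=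
  continuous_iff_continuousAt.2 fun t =>
    (analyticAt_of_re_eq_half L ν hPc hPcd hPre hcNF hcan hcc hFE (by simp)).continuousAt.comp (continuous_const.add (continuous_ofReal.mul continuous_const)).continuousAt

omit [BorelSpace (quasiSplit (↥(maximalRealSubfield L)) L (IsCMField.complexConj L) 2).Adelic] [ν.IsHaarMeasure] in
include hPc hPcd hPre hcNF hcan hcc in
/-- **(hs1) `‖cI(½ + it)‖ = 1` FOR EVERY REAL `t`, modulo (FE).**  At the axis points off `P`, `1 − P`, `conj P` — all but countably many, and eventually along `𝓝[≠] t` (§1) — `1 − z = conj z`,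
(FE) and the reflection symmetry ★ (136) `apply_conj_eq_conj_apply` give `‖cI z‖ = 1` (★ T2 `norm_eq_one_of_mul_one_sub_eq_one`); `t ↦ ‖cI(½ + it)‖` is continuous (`continuous_axis`),
and limits along `𝓝[≠] t` are unique. [cite: Iwaniec2002, §6.3, Thm 6.6] [cite: MoeglinWaldspurger1995, IV.3.12] -/
theorem norm_axis_eq_one (hFE : ∀ z : ℂ, z ∉ P → 1 - z ∉ P → cI z * cI (1 - z) = 1) (t : ℝ) : ‖cI ((((1 / 2 : ℝ)) : ℂ) + t * I)‖ = 1 := by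
  have hcont : ContinuousAt (fun u : ℝ => ‖cI ((((1 / 2 : ℝ)) : ℂ) + u * I)‖) t := ((continuous_axis L ν hPc hPcd hPre hcNF hcan hcc hFE).continuousAt).norm
  have hev : ∀ᶠ u : ℝ in 𝓝[≠] t, ‖cI ((((1 / 2 : ℝ)) : ℂ) + (u : ℂ) * I)‖ = 1 := by
    filter_upwards [eventually_axis_notMem hPcd t] with u hu
    exact norm_eq_one_of_mul_one_sub_eq_one (hFE _ hu.1 hu.2.1) (apply_conj_eq_conj_apply L ν hPc hPcd hPre hcan hcc hu.1 hu.2.2) (by simp)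
  exact tendsto_nhds_unique (hcont.tendsto.mono_left nhdsWithin_le_nhds) (tendsto_const_nhds.congr' (hev.mono fun u hu => hu.symm))

omit [BorelSpace (quasiSplit (↥(maximalRealSubfield L)) L (IsCMField.complexConj L) 2).Adelic] [ν.IsHaarMeasure] in
include hPc hPcd hPre hcNF hcan hcc in
/-- **(hss) `cI(½ − it) = conj cI(½ + it)` FOR EVERY REAL `t`, modulo (FE).**  Generically on the axis this is ★ (136) `apply_conj_eq_conj_apply` (`conj (½ + it) = ½ − it`); both sides are
continuous in `t` (`continuous_axis`), so the identity extends across the exceptional points (uniqueness of limits along `𝓝[≠] t`). [cite: MoeglinWaldspurger1995, IV.1.10] [cite: Langlands1976, §7] -/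
theorem axis_reflect (hFE : ∀ z : ℂ, z ∉ P → 1 - z ∉ P → cI z * cI (1 - z) = 1) (t : ℝ) :
    cI ((((1 / 2 : ℝ)) : ℂ) + ((-t : ℝ) : ℂ) * I) = conj (cI ((((1 / 2 : ℝ)) : ℂ) + t * I)) := by
  have h1 : ContinuousAt (fun u : ℝ => cI ((((1 / 2 : ℝ)) : ℂ) + ((-u : ℝ) : ℂ) * I)) t :=
    ((continuous_axis L ν hPc hPcd hPre hcNF hcan hcc hFE).comp continuous_neg).continuousAt
  have h2 : ContinuousAt (fun u : ℝ => conj (cI ((((1 / 2 : ℝ)) : ℂ) + u * I))) t :=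
    (continuous_conj.comp (continuous_axis L ν hPc hPcd hPre hcNF hcan hcc hFE)).continuousAt
  have hev : ∀ᶠ u : ℝ in 𝓝[≠] t, cI ((((1 / 2 : ℝ)) : ℂ) + ((-u : ℝ) : ℂ) * I) = conj (cI ((((1 / 2 : ℝ)) : ℂ) + (u : ℂ) * I)) := by
    filter_upwards [eventually_axis_notMem hPcd t] with u hu
    rw [← conj_vertical]
    exact apply_conj_eq_conj_apply L ν hPc hPcd hPre hcan hcc hu.1 hu.2.2
  exact tendsto_nhds_unique (h1.tendsto.mono_left nhdsWithin_le_nhds) ((h2.tendsto.mono_left nhdsWithin_le_nhds).congr' (hev.mono fun u hu => hu.symm))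

/-! ## §3 HEAD: the Plancherel form of the radial unitary-axis inner product formula, modulo (FE) -/

include h𝓕N h𝓕c hPc hPcd hPre hcNF hcan hcc in
/-- **HEAD — THE PLANCHEREL FORM `⟪θ_f, θ_{f′}⟫ = ⟪Uθ_f, Uθ_{f′}⟫` OF THE RADIAL PSEUDO-EISENSTEIN FAMILY, MODULO (FE).**  For `f, f′ ∈ C²_c((0,∞))`, `σ₀ > 1`, the T1 strip bound `hB`
and the inner-product identity `hIP` on `Re = σ₀` (★ (136)'s letters verbatim): `∃ r ≠ 0` with `(z − 1)·cI(z) → r` and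
`IP = C·(r·f̃(−1)·conj f̃′(−1)) + C·((2π)⁻¹·∫_0^∞ U_f(t)·conj U_{f′}(t) dt)`, `U_f(t) = f̃(−(½+it)) + cI(½−it)·f̃(−(½−it))` — ★ (136) `pseudoEisenstein_contourShift_of_fe`, then ★ T5a
`plancherelForm_of_innerProductFormula (mellin f) (mellin f′) cI` with (hs1) = `norm_axis_eq_one`, (hss) = `axis_reflect`, (hG) = ★ T4b `integrable_innerProductIntegrand_vertical` at
`σ = ½` on ★ (136)'s neighbourhood. [cite: MoeglinWaldspurger1995, II.2.4, IV.3.12] [cite: Iwaniec2002, §7.3] [cite: Langlands1976, §7] -/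
theorem pseudoEisenstein_plancherelForm_of_fe (hFE : ∀ z : ℂ, z ∉ P → 1 - z ∉ P → cI z * cI (1 - z) = 1)
    {f f' : ℝ → ℂ} (hf : ContDiff ℝ 2 f) (hfs : HasCompactSupport f) (hf0 : tsupport f ⊆ Ioi 0)
    (hf' : ContDiff ℝ 2 f') (hf's : HasCompactSupport f') (hf'0 : tsupport f' ⊆ Ioi 0) {σ₀ : ℝ} (hσ₀ : 1 < σ₀)
    {B : ℝ} (hB : ∀ z : ℂ, 1 / 2 < z.re → z.re ≤ σ₀ → 1 ≤ |z.im| → ‖cI z‖ ≤ B)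
    {IP C : ℂ} (hIP : IP = C * ((((2 * π)⁻¹ : ℝ) : ℂ) * ∫ y : ℝ, mellin f (-((σ₀ : ℂ) + y * I)) *
      (conj (mellin f' (-(1 - conj ((σ₀ : ℂ) + y * I)))) + cI ((σ₀ : ℂ) + y * I) * conj (mellin f' (-conj ((σ₀ : ℂ) + y * I)))))) :
    ∃ r : ℂ, r ≠ 0 ∧ Tendsto (fun z : ℂ => (z - 1) * cI z) (𝓝[≠] 1) (𝓝 r) ∧
      IP = C * (r * (mellin f (-1) * conj (mellin f' (-1)))) + C * ((((2 * π)⁻¹ : ℝ) : ℂ) * ∫ t in Ioi (0 : ℝ),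
        (mellin f (-((((1 / 2 : ℝ)) : ℂ) + t * I)) + cI ((((1 / 2 : ℝ)) : ℂ) + ((-t : ℝ) : ℂ) * I) * mellin f (-((((1 / 2 : ℝ)) : ℂ) + ((-t : ℝ) : ℂ) * I))) *
          conj (mellin f' (-((((1 / 2 : ℝ)) : ℂ) + t * I)) + cI ((((1 / 2 : ℝ)) : ℂ) + ((-t : ℝ) : ℂ) * I) * mellin f' (-((((1 / 2 : ℝ)) : ℂ) + ((-t : ℝ) : ℂ) * I)))) := by
  obtain ⟨r, hr0, hr, hIP'⟩ := pseudoEisenstein_contourShift_of_fe L ν h𝓕N h𝓕c hPc hPcd hPre hcNF hcan hcc hFE hf hfs hf0 hf' hf's hf'0 hσ₀ hB hIP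
  refine ⟨r, hr0, hr, ?_⟩
  -- (hG): integrability of the axis integrand at `σ = ½` (★ T4b on ★ (136)'s neighbourhood of `{Re ≥ ½}`)
  obtain ⟨⟨U, hUo, hUs, hc⟩, -⟩ := exists_isOpen_differentiableOn_of_fe L ν h𝓕N h𝓕c hPc hPcd hPre hcNF hcan hcc hFE
  have hUs' : {z : ℂ | 1 / 2 ≤ z.re ∧ z.re ≤ σ₀} ⊆ U := fun z hz => hUs hz.1
  have hG : Integrable fun y : ℝ => mellin f (-((((1 / 2 : ℝ)) : ℂ) + y * I)) *
      (conj (mellin f' (-(1 - conj ((((1 / 2 : ℝ)) : ℂ) + y * I)))) + cI ((((1 / 2 : ℝ)) : ℂ) + y * I) * conj (mellin f' (-conj ((((1 / 2 : ℝ)) : ℂ) + y * I)))) := by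
    have h := integrable_innerProductIntegrand_vertical hf hfs hf0 hf' hf's hf'0 hσ₀ hUo hUs' hc hB 1 (σ := 1 / 2) le_rfl (by linarith) (by norm_num)
    simpa only [ofReal_one, one_mul] using h
  exact plancherelForm_of_innerProductFormula (mellin f) (mellin f') cI hIP' (norm_axis_eq_one L ν hPc hPcd hPre hcNF hcan hcc hFE)
    (axis_reflect L ν hPc hPcd hPre hcNF hcan hcc hFE) hG

include h𝓕N h𝓕c hPc hPcd hPre hcNF hcan hcc in
/-- **THE NORM FORM — THE ISOMETRY CLAUSE OF ROADCARD T5 FOR THE RADIAL FAMILY, MODULO (FE)** (`f′ = f`): `IP = C·(r·|f̃(−1)|²) + C·((2π)⁻¹·∫_0^∞ |U_f(t)|² dt)`, i.e.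
`⟪θ_f, θ_f⟫ = ‖Uθ_f‖²` in `ℂ ⊕ L²((0,∞))` with weights `(C·r, C·(2π)⁻¹)`, `Uθ_f = (f̃(−1), U_f)`. [cite: MoeglinWaldspurger1995, IV.3.12] [cite: Iwaniec2002, §7.3] -/
theorem pseudoEisenstein_plancherelNorm_of_fe (hFE : ∀ z : ℂ, z ∉ P → 1 - z ∉ P → cI z * cI (1 - z) = 1)
    {f : ℝ → ℂ} (hf : ContDiff ℝ 2 f) (hfs : HasCompactSupport f) (hf0 : tsupport f ⊆ Ioi 0) {σ₀ : ℝ} (hσ₀ : 1 < σ₀)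
    {B : ℝ} (hB : ∀ z : ℂ, 1 / 2 < z.re → z.re ≤ σ₀ → 1 ≤ |z.im| → ‖cI z‖ ≤ B)
    {IP C : ℂ} (hIP : IP = C * ((((2 * π)⁻¹ : ℝ) : ℂ) * ∫ y : ℝ, mellin f (-((σ₀ : ℂ) + y * I)) *
      (conj (mellin f (-(1 - conj ((σ₀ : ℂ) + y * I)))) + cI ((σ₀ : ℂ) + y * I) * conj (mellin f (-conj ((σ₀ : ℂ) + y * I)))))) :
    ∃ r : ℂ, r ≠ 0 ∧ Tendsto (fun z : ℂ => (z - 1) * cI z) (𝓝[≠] 1) (𝓝 r) ∧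
      IP = C * (r * ((‖mellin f (-1)‖ ^ 2 : ℝ) : ℂ)) + C * ((((2 * π)⁻¹ : ℝ) : ℂ) * ∫ t in Ioi (0 : ℝ),
        (((‖mellin f (-((((1 / 2 : ℝ)) : ℂ) + t * I)) + cI ((((1 / 2 : ℝ)) : ℂ) + ((-t : ℝ) : ℂ) * I) * mellin f (-((((1 / 2 : ℝ)) : ℂ) + ((-t : ℝ) : ℂ) * I))‖ ^ 2 : ℝ)) : ℂ)) := by
  obtain ⟨r, hr0, hr, hIP'⟩ := pseudoEisenstein_contourShift_of_fe L ν h𝓕N h𝓕c hPc hPcd hPre hcNF hcan hcc hFE hf hfs hf0 hf hfs hf0 hσ₀ hB hIP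
  refine ⟨r, hr0, hr, ?_⟩
  obtain ⟨⟨U, hUo, hUs, hc⟩, -⟩ := exists_isOpen_differentiableOn_of_fe L ν h𝓕N h𝓕c hPc hPcd hPre hcNF hcan hcc hFE
  have hUs' : {z : ℂ | 1 / 2 ≤ z.re ∧ z.re ≤ σ₀} ⊆ U := fun z hz => hUs hz.1
  have hG : Integrable fun y : ℝ => mellin f (-((((1 / 2 : ℝ)) : ℂ) + y * I)) *
      (conj (mellin f (-(1 - conj ((((1 / 2 : ℝ)) : ℂ) + y * I)))) + cI ((((1 / 2 : ℝ)) : ℂ) + y * I) * conj (mellin f (-conj ((((1 / 2 : ℝ)) : ℂ) + y * I)))) := by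
    have h := integrable_innerProductIntegrand_vertical hf hfs hf0 hf hfs hf0 hσ₀ hUo hUs' hc hB 1 (σ := 1 / 2) le_rfl (by linarith) (by norm_num)
    simpa only [ofReal_one, one_mul] using h
  exact plancherelNorm_of_innerProductFormula (mellin f) cI hIP' (norm_axis_eq_one L ν hPc hPcd hPre hcNF hcan hcc hFE)
    (axis_reflect L ν hPc hPcd hPre hcNF hcan hcc hFE) hG

end Scalar

end Summit.HodgeConjecture.HodgeConjecture.Cruxes.H413.K2E1PseudoEisensteinPlancherelRadialCMTwo

end
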